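import Summits.QuantumFields.BalabanUV.Gaps.D1Residue
import Summits.QuantumFields.BalabanUV.Beta.FP.StepRecursionFeed
import Literature.MathematicalPhysics.QuantumFieldTheory.Balaban1983to89.T4ContinuumYM4Torus

/-!
# `BalabanUV.Gaps.D1RoadsJunction` — cell `pub-balaban-gaps` (YM blitz Y1), track G1, seat g1-p1 (gen 2): **ROW (D1)'s TWO ROADS JOINED IN THE KERNEL —
# road FP's DISPLAYED ROWS (d1-p3 #28 `FP.StepRecursionFeed`, (L1)(L2′)(L4′) + the `m = 1` anchor) ⟹ EXACT TELESCOPING ⟹ (D1) AT THE LITERAL OF RECORD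
# ⟺ THE ONE-SHOT LAW OF THE COMPOSITE FAMILY — NO printed input, NO symmetry letter, NO window, NO lock**

HONEST FRAMING (page 1, cell contract).  WHAT THIS IS: [folklore] compositions BY NAME — the road-FP owner's landed END
`Beta.FP.StepRecursionFeed.d1Tel_anchored_of_kernel_laws_wStep` (p341107 ✓; its kernel rows are HYPOTHESES here exactly as there) with the cell's (D1) statement files
`Gaps.D1Residue` (p340834 ✓) ∕ `Gaps.D1BinderEnds` (p339608 ✓) and the β-sub-cell's `HidentScalewise.flowSum_eq_oneShotReadout`.  WHAT THIS IS NOT: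
not a proof of (D1), of `D1Tel`, of `D1Rep` or of any kernel row; nothing of Bałaban's papers asserted, valued or discharged ([B12] Theorem 2, CMP 109 (1987) p. 259, printed
WITHOUT proof; [B16] CMP 122 p. 355); NOT `BetaPertH`, NOT the continuum limit, NOT Clay.  HONEST DEPENDENCY (verbatim): continuum YM on T⁴ ⇐ BetaPertH ∧ nine spine
estimates (0/9 proved); BetaPertH ⇐ (D1) ∧ (D4) ∧ CAP+tail; G-an2-4 gates asym, D1 and NE2/3/4.

WHY.  Row (D1) = `D1Drift` at the (III′) literal of record has two roads: FP (d1-p3) delivers the telescoping `D1Tel` of the step jets onto ONE composite family `Jc`,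
BF-x (d1-p2) delivers `D1Rep` ∕ the one-shot law for the same `Jc` (an2 R-D1-g42-4: `Jc` = the composite-contour literal, anchored at `m = 1` by `JcOf`).  Road FP's head
#28 §5 now PRODUCES M‴'s `htel` shape from DISPLAYED kernel rows — (L1) the door law `𝒦N j = 𝒦F j + 𝒦G j` (`j ≥ 1`), (L2′) the three identifications of `𝒦N 𝒦F 𝒦G`
with the one-shot kernels at scales `j+1`, `j` (dressed at the canonical weight `wStep Lc j`) and the step kernel, (L4′) the zeroth- and first-moment laws (T0)(T1) of the
step kernels of record, + the anchor `hJc1 : Jc 1 = JcOf … 1`.  THIS FILE observes that THOSE SAME ROWS already close the cell's (D1) ⟺ (OSL) equivalence with NOTHING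
else displayed: (T0)(T1) are exactly the per-step data `flowSum_eq_oneShotReadout` consumes (with `AbsMoment₂` from `hTA_TbalOf`), so `D1Tel` + (T0)(T1) give the EXACT
read-out identity `Σ_{j<m} β⁰_j = secondMoment (TshotOf Lc Jc m) μ ν` (§1, `readout_eq_of_D1Tel_T0T1` — the hW∕hR-free twin of `D1CumJcFree.readout_eq_of_D1Tel`), hence
(RB) with `U′ = 0`, hence by two-out-of-three (§2):
  **road FP's rows at `Jc` ⟹ ( (D1) at the literal of record ⟺ `OneShotLaw Lc Jc Nc μ ν` )** — for ANY table parameters `cΛ cB`, any colour numeral `Nc`, any `μ ν`;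
no [B5] statement, no label, no window, no `μ ≠ ν`, no lock (`d1Drift_record_iff_oneShotLaw_of_fpRows`).
So, GIVEN road FP, the binder (D1) IS the one-shot law of the composite-contour family and nothing more; and road BF-x's `D1Rep` conclusion feeds the same junction
through ROOT M‴ (§3, printed [B5] + labels + locks displayed there, as M‴ has them); §4 carries the junction up to the T⁴ headline
(`continuumYM4Torus_of_fpRows_oneShotLaw_atSlope`: B1 ∧ B2 ∧ B5-under-endpoint-existence ∧ `hβ` ∧ [road FP's rows at `Jc`] ∧ `OneShotLaw Lc Jc N μ ν` ∧ row (D4)'s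
`AtSlope` ∧ (C) ⟹ `ContinuumYM4Torus D ∧ ContinuumYM4TorusE D` — the β-side of the print-faithful torus theorem with EVERY (D1)-ingredient opened down to the two roads'
deliverables).  0 rows discharged: every kernel row of road FP stays displayed.

ABSOLUTE RULE (cell charter, verbatim): «No internally-minted statement may enter as a cited fact. Every hypothesis is either kernel-proved in this package or a
verbatim quotation of a PUBLISHED theorem with page reference.»  No `def`, no `def … : Prop`, nothing cited as mathematics, 0 sorry, axioms ⊆ the standard trio.
Provenance: cell pub-balaban-gaps, seat g1-p1 gen 2, 2026-08-22; imports `Gaps.D1Residue` + d1-p3's `Beta.FP.StepRecursionFeed` (read-only, BY NAME) +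
`T4ContinuumYM4Torus` (§4); no existing file touched; nothing of road FP restated (its END is CALLED, its rows are passed through verbatim).
-/

noncomputable section

open Finset
open scoped BigOperators
open Literature.MathematicalPhysics.QuantumFieldTheory
open Literature.MathematicalPhysics.QuantumFieldTheory.Balaban1983to89
open Literature.MathematicalPhysics.QuantumFieldTheory.Balaban1983to89.Beta
open OneStepResolventKernel (JetData)
open OneStepKernelFamily (TbalOf TshotOf D1Tel D1Rep D1Drift hTA_TbalOf)
open B12Beta (secondMoment)
open DressedMomentNormalisation (EKer dressedEntry m2Tensor)
open ScalewiseVectorSeam (readout122 readout122_add readout122_m2Tensor)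
open HidentScalewise (flowSum_eq_oneShotReadout)
open HessianTelescopingKKT (wStep)
open FlowStep FlowStepRuns DagBinding
open RemainderResidue (AtSlope)
open T4Continuum (T4Family FiniteEpsData)
open T4ContinuumYM4Torus (ContinuumYM4Torus ContinuumYM4TorusE continuumYM4_torus_of_endpointExistence_nonvacuous)
open VectorTailsLoc (fam kfam)
open VectorLegVolumeAdapter (MvE)
open Summit.QuantumFields.BalabanUV.Beta.CombChartJointEnd (JsB12CombShSym)
open Summit.QuantumFields.BalabanUV.Beta.SymSecondOrderTablesAn1 (symTablesAn1S2)
open Summit.QuantumFields.BalabanUV.Beta.CombOneShotJets (JcOf)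
open Summit.QuantumFields.BalabanUV.Beta.FP.StepRecursionFeed (d1Tel_anchored_of_kernel_laws_wStep)
open Summit.QuantumFields.BalabanUV.Gaps.D1Residue

namespace Summit.QuantumFields.BalabanUV.Gaps.D1RoadsJunction

variable {Lc : ℕ} [NeZero Lc] {L : Type*}

/-! ## §1 The exact read-out identity from `D1Tel` + (T0)(T1) alone (no hW ∕ hR letter) -/

/-- [folklore] **THE EXACT READ-OUT IDENTITY, (T0)(T1) FORM**: Hessian telescoping `D1Tel Lc Js Jc` plus the zeroth- and first-moment laws (T0)(T1) of the step kernels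
(`AbsMoment₂` is automatic, `hTA_TbalOf`) give `Σ_{j<m} secondMoment (TbalOf Lc Js j) μ ν = secondMoment (TshotOf Lc Jc m) μ ν` for every `m ≥ 1`
(`HidentScalewise.flowSum_eq_oneShotReadout` at the (1.22) read-out).  The hW∕hR-free twin of `Gaps.D1CumJcFree.readout_eq_of_D1Tel`. -/
theorem readout_eq_of_D1Tel_T0T1 (Js : ℕ → JetData 3 Lc) (Jc : ∀ m : ℕ, JetData 3 (Lc ^ m))
    (hT0 : ∀ j (c e : Fin 4), HasSum (TbalOf Lc Js j c e) 0)
    (hT1 : ∀ j (c e ρ : Fin 4), HasSum (fun t : Fin 4 → ℤ => t ρ • TbalOf Lc Js j c e t) 0)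
    (htel : D1Tel Lc Js Jc) (μ ν : Fin 4) {m : ℕ} (hm : 1 ≤ m) :
    ∑ j ∈ range m, secondMoment (TbalOf Lc Js j) μ ν = secondMoment (TshotOf Lc Jc m) μ ν := by
  have hβ' : ∀ j, secondMoment (TbalOf Lc Js j) μ ν = readout122 μ ν (m2Tensor (TbalOf Lc Js j)) := fun j => by
    rw [readout122_m2Tensor]
  rw [flowSum_eq_oneShotReadout (hTA_TbalOf Js) hT0 hT1 htel (readout122_add μ ν) hβ' hm, readout122_m2Tensor]

/-- [folklore] **`D1Tel` + (T0)(T1) ⟹ (RB) with `U′ = 0`.** -/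
theorem readoutBdd_of_D1Tel_T0T1 (Js : ℕ → JetData 3 Lc) (Jc : ∀ m : ℕ, JetData 3 (Lc ^ m))
    (hT0 : ∀ j (c e : Fin 4), HasSum (TbalOf Lc Js j c e) 0)
    (hT1 : ∀ j (c e ρ : Fin 4), HasSum (fun t : Fin 4 → ℤ => t ρ • TbalOf Lc Js j c e t) 0)
    (htel : D1Tel Lc Js Jc) (μ ν : Fin 4) : ReadoutBdd Lc Js Jc μ ν :=
  ⟨0, fun m hm => by rw [readout_eq_of_D1Tel_T0T1 Js Jc hT0 hT1 htel μ ν hm, sub_self, abs_zero]⟩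

/-- [folklore] **`D1Tel` + (T0)(T1) ⟹ ( (D1) ⟺ `OneShotLaw` )** for ANY step jets `Js`, any composite partner `Jc`, any numeral `N`, any `μ ν` — no printed input. -/
theorem d1Drift_iff_oneShotLaw_of_D1Tel_T0T1 (Js : ℕ → JetData 3 Lc) (Jc : ∀ m : ℕ, JetData 3 (Lc ^ m))
    (hT0 : ∀ j (c e : Fin 4), HasSum (TbalOf Lc Js j c e) 0)
    (hT1 : ∀ j (c e ρ : Fin 4), HasSum (fun t : Fin 4 → ℤ => t ρ • TbalOf Lc Js j c e t) 0)
    (htel : D1Tel Lc Js Jc) {N : ℝ} {μ ν : Fin 4} : D1Drift Lc Js N μ ν ↔ OneShotLaw Lc Jc N μ ν :=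
  d1Drift_iff_oneShotLaw_of_readoutBdd Js Jc (readoutBdd_of_D1Tel_T0T1 Js Jc hT0 hT1 htel μ ν)

/-! ## §2 Junction with road FP's head: its displayed rows ⟹ ( (D1) at the literal ⟺ the one-shot law of the composite family ) -/

section FP

variable (hLc : Odd Lc) (N : ℕ) (cΛ cB : ℝ)

/-- [folklore] **ROAD FP's ROWS ⟹ (RB) ONTO THE COMPOSITE FAMILY, EXACTLY** (`U′ = 0`): d1-p3's `FP.StepRecursionFeed.d1Tel_anchored_of_kernel_laws_wStep` (its rows
(L1)(L2′)(L4′) + anchor passed through VERBATIM) followed by §1.  Any table parameters `cΛ cB`; any composite family `Jc` anchored at `m = 1`. -/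
theorem readoutBdd_record_of_fpRows (Jc : ∀ m : ℕ, JetData 3 (Lc ^ m)) (hJc1 : Jc 1 = JcOf hLc N (fun _ => cΛ) (fun _ => cB) 1)
    (𝒦N 𝒦F 𝒦G : ℕ → EKer 4)
    (hlaw : ∀ j : ℕ, 1 ≤ j → ∀ (a b : Fin 4) (z : Fin 4 → ℤ), 𝒦N j a b z = 𝒦F j a b z + 𝒦G j a b z)
    (hN : ∀ j : ℕ, 1 ≤ j → ∀ (a b : Fin 4) (z : Fin 4 → ℤ), 𝒦N j a b z = TshotOf Lc Jc (j + 1) a b z)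
    (hF : ∀ j : ℕ, 1 ≤ j → ∀ (a b : Fin 4) (z : Fin 4 → ℤ),
      𝒦F j a b z = (Lc : ℝ) ^ 8 * dressedEntry (wStep Lc j) (TshotOf Lc Jc j) ((Lc : ℤ) • z) a b)
    (hG : ∀ j : ℕ, 1 ≤ j → ∀ (a b : Fin 4) (z : Fin 4 → ℤ),
      𝒦G j a b z = TbalOf Lc (JsB12CombShSym hLc N (symTablesAn1S2 3 Lc cΛ) cΛ cB) j a b z)
    (hT0 : ∀ j (c e : Fin 4), HasSum (TbalOf Lc (JsB12CombShSym hLc N (symTablesAn1S2 3 Lc cΛ) cΛ cB) j c e) 0)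
    (hT1 : ∀ j (c e ρ : Fin 4), HasSum (fun t : Fin 4 → ℤ => t ρ • TbalOf Lc (JsB12CombShSym hLc N (symTablesAn1S2 3 Lc cΛ) cΛ cB) j c e t) 0)
    (μ ν : Fin 4) : ReadoutBdd Lc (JsB12CombShSym hLc N (symTablesAn1S2 3 Lc cΛ) cΛ cB) Jc μ ν :=
  readoutBdd_of_D1Tel_T0T1 _ Jc hT0 hT1 (d1Tel_anchored_of_kernel_laws_wStep hLc N cΛ cB Jc hJc1 𝒦N 𝒦F 𝒦G hlaw hN hF hG hT0 hT1) μ ν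

/-- [folklore] **THE JUNCTION: ROAD FP's ROWS ⟹ ( (D1) AT THE (III′) LITERAL ⟺ THE ONE-SHOT LAW OF THE COMPOSITE FAMILY )** — for any table parameters `cΛ cB`,
any colour numeral `Nc`, any `μ ν`, any composite family `Jc` anchored at `m = 1`; NO [B5] statement, NO label, NO window, NO `μ ≠ ν`, NO lock displayed.  Given road
FP, the binder (D1) IS `OneShotLaw Lc Jc Nc μ ν` — road BF-x's target — and nothing more.  0 kernel rows discharged. -/
theorem d1Drift_record_iff_oneShotLaw_of_fpRows (Jc : ∀ m : ℕ, JetData 3 (Lc ^ m)) (hJc1 : Jc 1 = JcOf hLc N (fun _ => cΛ) (fun _ => cB) 1)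
    (𝒦N 𝒦F 𝒦G : ℕ → EKer 4)
    (hlaw : ∀ j : ℕ, 1 ≤ j → ∀ (a b : Fin 4) (z : Fin 4 → ℤ), 𝒦N j a b z = 𝒦F j a b z + 𝒦G j a b z)
    (hN : ∀ j : ℕ, 1 ≤ j → ∀ (a b : Fin 4) (z : Fin 4 → ℤ), 𝒦N j a b z = TshotOf Lc Jc (j + 1) a b z)
    (hF : ∀ j : ℕ, 1 ≤ j → ∀ (a b : Fin 4) (z : Fin 4 → ℤ),
      𝒦F j a b z = (Lc : ℝ) ^ 8 * dressedEntry (wStep Lc j) (TshotOf Lc Jc j) ((Lc : ℤ) • z) a b)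
    (hG : ∀ j : ℕ, 1 ≤ j → ∀ (a b : Fin 4) (z : Fin 4 → ℤ),
      𝒦G j a b z = TbalOf Lc (JsB12CombShSym hLc N (symTablesAn1S2 3 Lc cΛ) cΛ cB) j a b z)
    (hT0 : ∀ j (c e : Fin 4), HasSum (TbalOf Lc (JsB12CombShSym hLc N (symTablesAn1S2 3 Lc cΛ) cΛ cB) j c e) 0)
    (hT1 : ∀ j (c e ρ : Fin 4), HasSum (fun t : Fin 4 → ℤ => t ρ • TbalOf Lc (JsB12CombShSym hLc N (symTablesAn1S2 3 Lc cΛ) cΛ cB) j c e t) 0)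
    {Nc : ℝ} {μ ν : Fin 4} :
    D1Drift Lc (JsB12CombShSym hLc N (symTablesAn1S2 3 Lc cΛ) cΛ cB) Nc μ ν ↔ OneShotLaw Lc Jc Nc μ ν :=
  d1Drift_iff_oneShotLaw_of_readoutBdd _ Jc (readoutBdd_record_of_fpRows hLc N cΛ cB Jc hJc1 𝒦N 𝒦F 𝒦G hlaw hN hF hG hT0 hT1 μ ν)

/-- [folklore] **… ITS UNCONDITIONAL HALF**: road FP's rows ∧ the one-shot law of the composite family ⟹ (D1) at the (III′) literal. -/
theorem d1Drift_record_of_fpRows_oneShotLaw (Jc : ∀ m : ℕ, JetData 3 (Lc ^ m)) (hJc1 : Jc 1 = JcOf hLc N (fun _ => cΛ) (fun _ => cB) 1)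
    (𝒦N 𝒦F 𝒦G : ℕ → EKer 4)
    (hlaw : ∀ j : ℕ, 1 ≤ j → ∀ (a b : Fin 4) (z : Fin 4 → ℤ), 𝒦N j a b z = 𝒦F j a b z + 𝒦G j a b z)
    (hN : ∀ j : ℕ, 1 ≤ j → ∀ (a b : Fin 4) (z : Fin 4 → ℤ), 𝒦N j a b z = TshotOf Lc Jc (j + 1) a b z)
    (hF : ∀ j : ℕ, 1 ≤ j → ∀ (a b : Fin 4) (z : Fin 4 → ℤ),
      𝒦F j a b z = (Lc : ℝ) ^ 8 * dressedEntry (wStep Lc j) (TshotOf Lc Jc j) ((Lc : ℤ) • z) a b)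
    (hG : ∀ j : ℕ, 1 ≤ j → ∀ (a b : Fin 4) (z : Fin 4 → ℤ),
      𝒦G j a b z = TbalOf Lc (JsB12CombShSym hLc N (symTablesAn1S2 3 Lc cΛ) cΛ cB) j a b z)
    (hT0 : ∀ j (c e : Fin 4), HasSum (TbalOf Lc (JsB12CombShSym hLc N (symTablesAn1S2 3 Lc cΛ) cΛ cB) j c e) 0)
    (hT1 : ∀ j (c e ρ : Fin 4), HasSum (fun t : Fin 4 → ℤ => t ρ • TbalOf Lc (JsB12CombShSym hLc N (symTablesAn1S2 3 Lc cΛ) cΛ cB) j c e t) 0)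
    {Nc : ℝ} {μ ν : Fin 4} (hosl : OneShotLaw Lc Jc Nc μ ν) :
    D1Drift Lc (JsB12CombShSym hLc N (symTablesAn1S2 3 Lc cΛ) cΛ cB) Nc μ ν :=
  (d1Drift_record_iff_oneShotLaw_of_fpRows hLc N cΛ cB Jc hJc1 𝒦N 𝒦F 𝒦G hlaw hN hF hG hT0 hT1).mpr hosl

/-- [folklore] **… AND ITS NECESSITY HALF**: road FP's rows ∧ (D1) at the (III′) literal ⟹ the one-shot law of the composite family — (OSL) is then FORCED. -/
theorem oneShotLaw_of_fpRows_d1Drift_record (Jc : ∀ m : ℕ, JetData 3 (Lc ^ m)) (hJc1 : Jc 1 = JcOf hLc N (fun _ => cΛ) (fun _ => cB) 1)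
    (𝒦N 𝒦F 𝒦G : ℕ → EKer 4)
    (hlaw : ∀ j : ℕ, 1 ≤ j → ∀ (a b : Fin 4) (z : Fin 4 → ℤ), 𝒦N j a b z = 𝒦F j a b z + 𝒦G j a b z)
    (hN : ∀ j : ℕ, 1 ≤ j → ∀ (a b : Fin 4) (z : Fin 4 → ℤ), 𝒦N j a b z = TshotOf Lc Jc (j + 1) a b z)
    (hF : ∀ j : ℕ, 1 ≤ j → ∀ (a b : Fin 4) (z : Fin 4 → ℤ),
      𝒦F j a b z = (Lc : ℝ) ^ 8 * dressedEntry (wStep Lc j) (TshotOf Lc Jc j) ((Lc : ℤ) • z) a b)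
    (hG : ∀ j : ℕ, 1 ≤ j → ∀ (a b : Fin 4) (z : Fin 4 → ℤ),
      𝒦G j a b z = TbalOf Lc (JsB12CombShSym hLc N (symTablesAn1S2 3 Lc cΛ) cΛ cB) j a b z)
    (hT0 : ∀ j (c e : Fin 4), HasSum (TbalOf Lc (JsB12CombShSym hLc N (symTablesAn1S2 3 Lc cΛ) cΛ cB) j c e) 0)
    (hT1 : ∀ j (c e ρ : Fin 4), HasSum (fun t : Fin 4 → ℤ => t ρ • TbalOf Lc (JsB12CombShSym hLc N (symTablesAn1S2 3 Lc cΛ) cΛ cB) j c e t) 0)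
    {Nc : ℝ} {μ ν : Fin 4} (hD : D1Drift Lc (JsB12CombShSym hLc N (symTablesAn1S2 3 Lc cΛ) cΛ cB) Nc μ ν) :
    OneShotLaw Lc Jc Nc μ ν :=
  (d1Drift_record_iff_oneShotLaw_of_fpRows hLc N cΛ cB Jc hJc1 𝒦N 𝒦F 𝒦G hlaw hN hF hG hT0 hT1).mp hD

end FP

/-! ## §3 Junction with road BF-x's conclusion currency `D1Rep`: road FP's rows ∧ `D1Rep` ⟹ (D1), through ROOT M‴ (locks, printed [B5], labels displayed as there) -/

/-- [folklore] **ROAD FP's ROWS ∧ ROAD BF-x's `D1Rep` ⟹ (D1) AT THE PINNED LITERAL** — ROOT M‴ (`Gaps.D1BinderEnds.d1Drift_record_of_D1Tel_D1Rep`, locks `2/Lc⁴`,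
`−Lc¹²/4` and window instantiated) with its `htel` slot FED by road FP's displayed rows at the same locks (d1-p3's `d1Tel_anchored_of_kernel_laws_wStep`); displayed:
FP's rows + anchor, `D1Rep Lc Jc Nc μ ν a SL k` (road BF-x's conclusion), the two printed [B5] statements BY NAME, labels, `μ ≠ ν`, `Nc ≠ 0`, `Odd Lc`, `2 ≤ Lc`, `2 ≤ N`.
0 rows of either road discharged. -/
theorem d1Drift_record_of_fpRows_D1Rep (hLc : Odd Lc) (hL2 : 2 ≤ Lc) {N : ℕ} (hN : 2 ≤ N)
    (Jc : ∀ m : ℕ, JetData 3 (Lc ^ m)) (hJc1 : Jc 1 = JcOf hLc N (fun _ => 2 / (Lc : ℝ) ^ 4) (fun _ => -((Lc : ℝ) ^ 12 / 4)) 1)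
    (𝒦N 𝒦F 𝒦G : ℕ → EKer 4)
    (hlaw : ∀ j : ℕ, 1 ≤ j → ∀ (a b : Fin 4) (z : Fin 4 → ℤ), 𝒦N j a b z = 𝒦F j a b z + 𝒦G j a b z)
    (hN' : ∀ j : ℕ, 1 ≤ j → ∀ (a b : Fin 4) (z : Fin 4 → ℤ), 𝒦N j a b z = TshotOf Lc Jc (j + 1) a b z)
    (hF : ∀ j : ℕ, 1 ≤ j → ∀ (a b : Fin 4) (z : Fin 4 → ℤ),
      𝒦F j a b z = (Lc : ℝ) ^ 8 * dressedEntry (wStep Lc j) (TshotOf Lc Jc j) ((Lc : ℤ) • z) a b)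
    (hG : ∀ j : ℕ, 1 ≤ j → ∀ (a b : Fin 4) (z : Fin 4 → ℤ), 𝒦G j a b z =
      TbalOf Lc (JsB12CombShSym hLc N (symTablesAn1S2 3 Lc (2 / (Lc : ℝ) ^ 4)) (2 / (Lc : ℝ) ^ 4) (-((Lc : ℝ) ^ 12 / 4))) j a b z)
    (hT0 : ∀ j (c e : Fin 4),
      HasSum (TbalOf Lc (JsB12CombShSym hLc N (symTablesAn1S2 3 Lc (2 / (Lc : ℝ) ^ 4)) (2 / (Lc : ℝ) ^ 4) (-((Lc : ℝ) ^ 12 / 4))) j c e) 0)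
    (hT1 : ∀ j (c e ρ : Fin 4), HasSum (fun t : Fin 4 → ℤ =>
      t ρ • TbalOf Lc (JsB12CombShSym hLc N (symTablesAn1S2 3 Lc (2 / (Lc : ℝ) ^ 4)) (2 / (Lc : ℝ) ^ 4) (-((Lc : ℝ) ^ 12 / 4))) j c e t) 0)
    (a : ℝ) (ha : 0 < a)
    (h12 : B5.Prop12Printed (fam (fun i : ℕ+ × ℕ => ((i.1 : ℕ+) : ℕ)) (fun i => i.1.pos) MvE a ha))
    (h126 : B5.Kernel126_127Printed (kfam (fun i : ℕ+ × ℕ => ((i.1 : ℕ+) : ℕ)) MvE))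
    {SL : Finset L} (hSL : SL.Nonempty) (k : L → Fin 4) {μ ν : Fin 4} (hμν : μ ≠ ν) {Nc : ℝ} (hNc : Nc ≠ 0)
    (hrep : D1Rep Lc Jc Nc μ ν a SL k) :
    D1Drift Lc (JsB12CombShSym hLc N (symTablesAn1S2 3 Lc (2 / (Lc : ℝ) ^ 4)) (2 / (Lc : ℝ) ^ 4) (-((Lc : ℝ) ^ 12 / 4))) Nc μ ν :=
  D1BinderEnds.d1Drift_record_of_D1Tel_D1Rep hLc hL2 hN a ha h12 h126 hSL k hμν hNc Jc
    (d1Tel_anchored_of_kernel_laws_wStep hLc N _ _ Jc hJc1 𝒦N 𝒦F 𝒦G hlaw hN' hF hG hT0 hT1) hrep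

/-- [folklore] **THE SAME IN THE SCHEME-FREE CURRENCY NEEDS NO LOCK, NO [B5], NO LABEL**: at the pinned literal, road FP's rows ∧ `OneShotLaw Lc Jc Nc μ ν` ⟹ (D1) is
just §2 at `cΛ := 2/Lc⁴`, `cB := −Lc¹²/4` — recorded to make the contrast with §3's M‴ route explicit (the printed [B5] input enters (D1) ONLY through the
`D1Rep ⟺ OneShotLaw` conversion, `D1Residue.oneShotLaw_iff_d1Rep`, never through the telescoping side). -/
theorem d1Drift_pinned_of_fpRows_oneShotLaw (hLc : Odd Lc) (N : ℕ)
    (Jc : ∀ m : ℕ, JetData 3 (Lc ^ m)) (hJc1 : Jc 1 = JcOf hLc N (fun _ => 2 / (Lc : ℝ) ^ 4) (fun _ => -((Lc : ℝ) ^ 12 / 4)) 1)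
    (𝒦N 𝒦F 𝒦G : ℕ → EKer 4)
    (hlaw : ∀ j : ℕ, 1 ≤ j → ∀ (a b : Fin 4) (z : Fin 4 → ℤ), 𝒦N j a b z = 𝒦F j a b z + 𝒦G j a b z)
    (hN' : ∀ j : ℕ, 1 ≤ j → ∀ (a b : Fin 4) (z : Fin 4 → ℤ), 𝒦N j a b z = TshotOf Lc Jc (j + 1) a b z)
    (hF : ∀ j : ℕ, 1 ≤ j → ∀ (a b : Fin 4) (z : Fin 4 → ℤ),
      𝒦F j a b z = (Lc : ℝ) ^ 8 * dressedEntry (wStep Lc j) (TshotOf Lc Jc j) ((Lc : ℤ) • z) a b)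
    (hG : ∀ j : ℕ, 1 ≤ j → ∀ (a b : Fin 4) (z : Fin 4 → ℤ), 𝒦G j a b z =
      TbalOf Lc (JsB12CombShSym hLc N (symTablesAn1S2 3 Lc (2 / (Lc : ℝ) ^ 4)) (2 / (Lc : ℝ) ^ 4) (-((Lc : ℝ) ^ 12 / 4))) j a b z)
    (hT0 : ∀ j (c e : Fin 4),
      HasSum (TbalOf Lc (JsB12CombShSym hLc N (symTablesAn1S2 3 Lc (2 / (Lc : ℝ) ^ 4)) (2 / (Lc : ℝ) ^ 4) (-((Lc : ℝ) ^ 12 / 4))) j c e) 0)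
    (hT1 : ∀ j (c e ρ : Fin 4), HasSum (fun t : Fin 4 → ℤ =>
      t ρ • TbalOf Lc (JsB12CombShSym hLc N (symTablesAn1S2 3 Lc (2 / (Lc : ℝ) ^ 4)) (2 / (Lc : ℝ) ^ 4) (-((Lc : ℝ) ^ 12 / 4))) j c e t) 0)
    {Nc : ℝ} {μ ν : Fin 4} (hosl : OneShotLaw Lc Jc Nc μ ν) :
    D1Drift Lc (JsB12CombShSym hLc N (symTablesAn1S2 3 Lc (2 / (Lc : ℝ) ^ 4)) (2 / (Lc : ℝ) ^ 4) (-((Lc : ℝ) ^ 12 / 4))) Nc μ ν :=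
  d1Drift_record_of_fpRows_oneShotLaw hLc N _ _ Jc hJc1 𝒦N 𝒦F 𝒦G hlaw hN' hF hG hT0 hT1 hosl

/-! ## §4 Up to the T⁴ headline: the β-side opened down to the two roads' deliverables -/

section Headline

variable {F : T4Family} {Ncol : ℕ} [NeZero Ncol]

/-- [folklore] **THE T⁴ HEADLINE FROM THE TWO ROADS' DELIVERABLES AND ROW (D4)'s RESIDUE**: a printed-averaged finite-ε datum `D` on `SU(Ncol)` (B1 `hD`), (B) (B2 `hB`),
the spine slot under endpoint existence (B5 `hNE`, 0/9 proved), a one-loop split `Sβ` of `D.βfun` whose one-loop coefficients are the (1.22) second moments of the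
(III′) step kernels (`hβ`), ROAD FP's DISPLAYED ROWS at a composite family `Jc` anchored at `m = 1` (d1-p3 #28 §5, passed verbatim), ROAD BF-x's TARGET
`OneShotLaw Lc Jc N μ ν`, ROW (D4)'s residue `AtSlope Sβ γ₀ (stepBal N Lc)` (g1-p2) and joint continuity (C) on the same box ⟹ `ContinuumYM4Torus D ∧ ContinuumYM4TorusE D`
(`continuumYM4_torus_of_endpointExistence_nonvacuous` ∘ `D1Residue.endpointExistence_of_residue_atSlope`, the residue inhabited by `⟨Jc, §2, hosl⟩`; forward generation =
`D.fwd`).  CAP + tail absent; no [B5] statement, no lock.  Every binder a hypothesis; 0 discharged. -/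
theorem continuumYM4Torus_of_fpRows_oneShotLaw_atSlope (D : FiniteEpsData F (Matrix.specialUnitaryGroup (Fin Ncol) ℂ))
    (hD : D.IsPrintedAveraged) (hB : B16.EndStatementBPrinted D.C) (hNE : T4ApexHybrid.HybridNE7Under D (EndpointExistence D.C.toB12))
    (Sβ : B12Beta.OneLoopSplit D.βfun) (hLc : Odd Lc) (Ng : ℕ) (cΛ cB : ℝ) {N : ℝ} {μ ν : Fin 4}
    (hβ : ∀ j, Sβ.β0 j = secondMoment (TbalOf Lc (JsB12CombShSym hLc Ng (symTablesAn1S2 3 Lc cΛ) cΛ cB) j) μ ν)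
    (Jc : ∀ m : ℕ, JetData 3 (Lc ^ m)) (hJc1 : Jc 1 = JcOf hLc Ng (fun _ => cΛ) (fun _ => cB) 1)
    (𝒦N 𝒦F 𝒦G : ℕ → EKer 4)
    (hlaw : ∀ j : ℕ, 1 ≤ j → ∀ (a b : Fin 4) (z : Fin 4 → ℤ), 𝒦N j a b z = 𝒦F j a b z + 𝒦G j a b z)
    (hN' : ∀ j : ℕ, 1 ≤ j → ∀ (a b : Fin 4) (z : Fin 4 → ℤ), 𝒦N j a b z = TshotOf Lc Jc (j + 1) a b z)
    (hF : ∀ j : ℕ, 1 ≤ j → ∀ (a b : Fin 4) (z : Fin 4 → ℤ),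
      𝒦F j a b z = (Lc : ℝ) ^ 8 * dressedEntry (wStep Lc j) (TshotOf Lc Jc j) ((Lc : ℤ) • z) a b)
    (hG : ∀ j : ℕ, 1 ≤ j → ∀ (a b : Fin 4) (z : Fin 4 → ℤ),
      𝒦G j a b z = TbalOf Lc (JsB12CombShSym hLc Ng (symTablesAn1S2 3 Lc cΛ) cΛ cB) j a b z)
    (hT0 : ∀ j (c e : Fin 4), HasSum (TbalOf Lc (JsB12CombShSym hLc Ng (symTablesAn1S2 3 Lc cΛ) cΛ cB) j c e) 0)
    (hT1 : ∀ j (c e ρ : Fin 4), HasSum (fun t : Fin 4 → ℤ => t ρ • TbalOf Lc (JsB12CombShSym hLc Ng (symTablesAn1S2 3 Lc cΛ) cΛ cB) j c e t) 0)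
    (hosl : OneShotLaw Lc Jc N μ ν)
    {γ₀ : ℝ} (hγ₀ : 0 < γ₀) (hslope : AtSlope Sβ γ₀ (B12Normalization.stepBal N Lc)) (hcont : BetaContH γ₀ D.βfun) :
    ContinuumYM4Torus D ∧ ContinuumYM4TorusE D :=
  continuumYM4_torus_of_endpointExistence_nonvacuous D hD hB
    (endpointExistence_of_residue_atSlope D.fwd Sβ _ hβ
      ⟨Jc, readoutBdd_record_of_fpRows hLc Ng cΛ cB Jc hJc1 𝒦N 𝒦F 𝒦G hlaw hN' hF hG hT0 hT1 μ ν, hosl⟩ hγ₀ hslope hcont) hNE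

end Headline

end Summit.QuantumFields.BalabanUV.Gaps.D1RoadsJunction

end
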